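import Literature.AlgebraicGeometry.Motives.AbelianVarietyGoodReductionHom
import HarnessLib

/-!
# Reduction of homomorphisms: the generic- and special-fibre pins of `HomReduction`, as `Over`-level equations

Topic `Literature/AlgebraicGeometry/Motives`; THEOREMS ONLY (no definition, no named fact, no instance; net Literature
debt 0).  Accessor leaf for the tree's reduction-of-homomorphisms datum `GoodReductionAt.HomReduction R S`
(`AbelianVarietyGoodReductionHom`): its two defining pins `liftHom_left_comp` (generic fibre of the lift `= λ`) and
`redHom_left_comp` (special fibre of the lift `= λ̃`), stated there on UNDERLYING SCHEME maps, are re-exported as equations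
of morphisms OVER `Spec K` / `Spec κ(v)` and in solved form — the shapes consumed by the naturality of the reduction map
(`AbelianSchemeModelReductionNaturality`, hypotheses `hFf` / `hFv`) and by the Tate-compatibility clause
`HomReduction.IsTateCompatible` for PRODUCED data (cell `hodgecm-mathlib`, programme E4, piece Q2; director g3 BATCH 90).
Parallel to `GoodReductionAt.map_liftEnd_comp_genericIso_hom` / `redEnd_comp_reductionIso_hom`
(`AbelianVarietyGoodReductionConjugate` §4) for endomorphisms.  [Shimura1998] §11.1 Prop. 12 («the reduction `λ̃` of
`λ`»), [BombieriGubler2006] 10.3.9.  HC_CM is proved only modulo the 7 printed citations until rung 0 closes.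
-/

set_option autoImplicit false

noncomputable section

open CategoryTheory AlgebraicGeometry IsDedekindDomain IsDedekindDomain.HeightOneSpectrum
open scoped NumberField

namespace Literature.AlgebraicGeometry.Motives

namespace AbelianVariety

namespace GoodReductionAt

namespace HomReduction

variable {K : Type} [Field K] [NumberField K] {A₀ B₀ : AbelianVariety K} {v : HeightOneSpectrum (𝓞 K)}
  {R : A₀.GoodReductionAt v} {S : B₀.GoodReductionAt v} (H : HomReduction R S)

/-- **The generic-fibre square of a reduction-of-homomorphisms datum, over `Spec K`**: `(liftHom λ)_K ≫ e_S = e_R ≫ λ`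
(the pin `liftHom_left_comp`, lifted from underlying schemes to `K`-schemes by `Over.OverMorphism.ext`).
[cite: BombieriGubler2006, 10.3.9 (p. 334)] -/
@[reassoc]
theorem map_liftHom_comp_genericIso_hom (f : A₀ ⟶ B₀) :
    (baseChangeHom (algebraMap (valuationSubringAtPrime K v) K)).map (H.liftHom f) ≫ S.model.genericIso.hom =
      R.model.genericIso.hom ≫ f.hom.hom.hom :=
  Over.OverMorphism.ext (H.liftHom_left_comp f)

/-- Solved form: the generic fibre of the lift IS `e_R ≫ λ ≫ e_S⁻¹`. [cite: BombieriGubler2006, 10.3.9 (p. 334)] -/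
theorem map_liftHom_eq (f : A₀ ⟶ B₀) :
    (baseChangeHom (algebraMap (valuationSubringAtPrime K v) K)).map (H.liftHom f) =
      R.model.genericIso.hom ≫ f.hom.hom.hom ≫ S.model.genericIso.inv :=
  ((Iso.eq_comp_inv S.model.genericIso).mpr (H.map_liftHom_comp_genericIso_hom f)).trans (Category.assoc _ _ _)

/-- **The special-fibre square of a reduction-of-homomorphisms datum, over `Spec κ(v)`**:
`λ̃ ≫ r_S = r_R ≫ (liftHom λ)_κ` (the pin `redHom_left_comp` as an equation of `κ(v)`-morphisms).
[cite: Shimura1998, §11.1 Prop. 12 (§11, pp. 83–87)] -/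
@[reassoc]
theorem redHom_comp_reductionIso_hom (f : A₀ ⟶ B₀) :
    (H.redHom f : R.reduction ⟶ S.reduction).hom.hom.hom ≫ S.reductionIso.hom =
      R.reductionIso.hom ≫ (baseChangeHom (residueAt v)).map (H.liftHom f) :=
  Over.OverMorphism.ext (H.redHom_left_comp f)

/-- Solved form: the underlying `κ(v)`-morphism of `λ̃ = redHom λ` IS `r_R ≫ (liftHom λ)_κ ≫ r_S⁻¹`.
[cite: Shimura1998, §11.1 Prop. 12 (§11, pp. 83–87)] -/
theorem redHom_hom_eq (f : A₀ ⟶ B₀) :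
    (H.redHom f : R.reduction ⟶ S.reduction).hom.hom.hom =
      R.reductionIso.hom ≫ (baseChangeHom (residueAt v)).map (H.liftHom f) ≫ S.reductionIso.inv :=
  ((Iso.eq_comp_inv S.reductionIso).mpr (H.redHom_comp_reductionIso_hom f)).trans (Category.assoc _ _ _)

/-- **Uniqueness pins the lift**: if `(liftHom λ)_K` is determined by `λ` (it is, by the square above), then any
`𝓞_{K,v}`-morphism of the models with the same generic fibre IS `liftHom λ`, provided restriction to the generic fibre is
injective on morphisms `R.model.total ⟶ S.model.total` (e.g. flat source, separated target — the uniqueness half of the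
Néron mapping property). [cite: BombieriGubler2006, 10.3.9 (p. 334)] -/
theorem liftHom_eq_of_map_eq (f : A₀ ⟶ B₀) (F : R.model.total ⟶ S.model.total)
    (hinj : Function.Injective fun g : R.model.total ⟶ S.model.total =>
      (baseChangeHom (algebraMap (valuationSubringAtPrime K v) K)).map g)
    (hF : (baseChangeHom (algebraMap (valuationSubringAtPrime K v) K)).map F =
      R.model.genericIso.hom ≫ f.hom.hom.hom ≫ S.model.genericIso.inv) :
    H.liftHom f = F :=
  hinj ((H.map_liftHom_eq f).trans hF.symm)

end HomReduction

end GoodReductionAt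

end AbelianVariety

end Literature.AlgebraicGeometry.Motives

end
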